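import Literature.MathematicalPhysics.QuantumFieldTheory.Balaban1983to89.B13Geometry236
import Literature.MathematicalPhysics.QuantumFieldTheory.Balaban1983to89.B16SProfile

/-!
# `Balaban1983to89.TreeLengthDichotomy` — the linear size `d_j(X)` of a union of lattice cubes is `0` or `≥ 1`;
the thresholds `d′ > 0` / `d′ = 0` of [Balaban1989LargeFieldII] p. 384–385 in their PRINTED form

CITATION HEADER (lean-in-tree rule 2026-08-18).  Definition modelled: T. Bałaban, *Renormalization group approach to
lattice gauge field theories. I*, Commun. Math. Phys. **109**, 249–301 (1987) [Balaban1987RG1] (cell paper B12), p. 257,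
verbatim: *"Consider a class of tree graphs contained in X and intersecting all the cubes in X. A length of a shortest
graph in this class, divided by M, is the linear size of X, and is denoted by d_j(X)."* — typed by the cell as
`TreeLength.treeLen` (infimum of the sup-metric lengths of connected polygonal graphs in the unit-cube picture; module
`…TreeLength`, its conventions (i)–(iii)).  Passage served: T. Bałaban, *Large field renormalization. II*, Commun. Math.
Phys. **122**, 355–392 (1989) [Balaban1989LargeFieldII] (cell paper B16), p. 384–385 [PDF 30–31], verbatim (p. 384, last
clause of the display after (1.80)): *"if the linear size on the right-hand side is different from 0, or d′_n(S^{n−j}(Z)) ≦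
(64)^d if it is equal to 0."* and (p. 385, ll. 2–3): *"Let n₀ be the last index n such that d′_n(Z^{(n−j)}) > 0. Then
S^{n₀+1−j}(Z) is contained in a cube of the size 64MR_{n₀+1}"* — the regime split of (1.81) by the PRINTED thresholds
«different from 0» / «equal to 0» / «> 0» on the linear size d′_n(Z^{(n−j)}) of the cover; the cell's READING of it (not a
quotation; v1 of this header presented it as one — cell `GAPS.md` G-pv14-12, corrected in this v1.1): «d′_n(Z^{(n−j)}) > 0 for
j < n ≤ n₀ and = 0 for n₀ < n», which the sibling module `…B16SProfile` (this unit, gen 9) typed with the thresholds `d′ ≥ 1` /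
`d′ < 1` (cell DIVERGENCE D-b02g9.1 (c)).  Both papers are manuscripts UNDER ADJUDICATION by the audit cell
`pub-balaban`: NOTHING printed in them is asserted here.  Every `theorem` below is elementary sup-metric geometry of the
integer grid, proved without `sorry` and without new axioms over the EXISTING definitions `TreeLength.{treeLen, len,
lenIn, Admissible, cube}`, `B13ScaleTransfer.{Pt, FaceConnected, closureIdx}`, `B16SProfile.{Qprod, ratio, Siter,
DropCtl}`, reusing `B13Geometry236.{exists_common_point, admissible_point, lenIn_le_len}` (Helly half) and
`TreeLength.le_lenIn_closedBall` (capture lemma).  NEW leaf module (unit b2b-balaban-b02, gen 9): imports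
`…B13Geometry236`, `…B16SProfile`; modifies nothing.  v1.1 (same unit, gen 9): DOCSTRINGS ONLY — the quotation loci of
this header and of `exists_threshold_printed` corrected after the cross-read recorded in cell `GAPS.md` C-pv14-38 /
G-pv14-12; no declaration, statement or proof changed.

WHAT IS PROVED.  Part 1: for ANY finite index set `X ⊆ ℤᵈ`, `treeLen X = 0 ∨ 1 ≤ treeLen X` (`treeLen_dichotomy`) —
if two cubes of `X` are ≥ 2 apart in some coordinate, every admissible graph joins two points at sup-distance ≥ 1 and the
capture lemma gives length ≥ 1 (`one_le_len_of_far`); otherwise all cubes of `X` share a point and the one-point graph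
has length 0 (`treeLen_eq_zero_of_near`); an index set without admissible graphs has the junk value 0.  Hence
`treeLen X < 1 ↔ treeLen X = 0` and `0 < treeLen X ↔ 1 ≤ treeLen X` (`treeLen_lt_one_iff`, `treeLen_pos_iff`), and a
face-connected `X` with `d(X) = 0` lies in a block of `2ᵈ` cubes (`card_le_two_pow_of_treeLen_lt_one`; the exact small-set
case of the cell's repaired volume bound `TreeLength.card_le_treeLen`, cell GAPS G-B13-07).  Part 2: the threshold lemma
and the two profile bounds of `…B16SProfile` restated with the PRINTED thresholds `d′ > 0` / `d′ = 0`
(`exists_threshold_printed`, `profile_h1_printed`, `profile_h2_printed`) — so D-b02g9.1 (c) is a difference of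
wording only: on the cell's model the typed and the printed regime splits coincide.

VALUE: a kernel-checked fact about the cell's MODEL of `d_j` that aligns a typed threshold with the printed one; NOT a
claim about the papers, NOT summit progress (rung (B)+1 ≠ infinite volume / mass gap / Clay).
-/

namespace Literature.MathematicalPhysics.QuantumFieldTheory.Balaban1983to89.TreeLengthDichotomy

open Literature.MathematicalPhysics.QuantumFieldTheory.Balaban1983to89
open Literature.MathematicalPhysics.QuantumFieldTheory.Balaban1983to89.B13ScaleTransfer
open Literature.MathematicalPhysics.QuantumFieldTheory.Balaban1983to89.TreeLength
open Literature.MathematicalPhysics.QuantumFieldTheory.Balaban1983to89.B13Geometry236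
open Literature.MathematicalPhysics.QuantumFieldTheory.Balaban1983to89.B16SProfile

noncomputable section

variable {d : ℕ}

/-! ## Part 1. The dichotomy `d(X) = 0 ∨ d(X) ≥ 1` -/

/-- The cubes of `X` PAIRWISE TOUCH: their indices differ by at most 1 in every coordinate (the hypothesis of
`B13Geometry236.exists_common_point`, named). [folklore] -/
def Near (X : Finset (Pt d)) : Prop := ∀ c₁ ∈ X, ∀ c₂ ∈ X, ∀ μ, c₂ μ ≤ c₁ μ + 1

/-- If the cubes of a non-empty `X` pairwise touch, `d(X) = 0`: they have a common point (Helly for grid cubes,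
`B13Geometry236.exists_common_point`) and the one-point graph there is admissible of length 0. [folklore] -/
theorem treeLen_eq_zero_of_near {X : Finset (Pt d)} (hne : X.Nonempty) (h : Near X) : treeLen X = 0 := by
  obtain ⟨q, hq⟩ := exists_common_point hne h
  have h1 : treeLen X ≤ len [(q, q)] := treeLen_le_len (admissible_point hne hq)
  have h2 : len [(q, q)] = 0 := by simp
  exact le_antisymm (h1.trans h2.le) (treeLen_nonneg X)

/-- TWO CUBES TWO APART COST LENGTH ONE: if `x, y ∈ X` have `x_μ + 2 ≤ y_μ` for some coordinate `μ`, every admissible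
graph of `X` has length ≥ 1 — it contains a point of the cube `x` and a point of the cube `y`, at sup-distance ≥ 1, and
the capture lemma `TreeLength.le_lenIn_closedBall` applies. [folklore] -/
theorem one_le_len_of_far {X : Finset (Pt d)} {T : List (Seg d)} (hT : Admissible X T) {x y : Pt d} (hx : x ∈ X)
    (hy : y ∈ X) {μ : Fin d} (hfar : x μ + 2 ≤ y μ) : 1 ≤ len T := by
  obtain ⟨p, hpT, hpx⟩ := hT.meets x hx
  obtain ⟨q, hqT, hqy⟩ := hT.meets y hy
  have hp := (mem_cube.1 hpx μ).2
  have hq := (mem_cube.1 hqy μ).1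
  have hc : ((x μ : ℤ) : ℝ) + 2 ≤ (y μ : ℝ) := by exact_mod_cast hfar
  have hdist : (1 : ℝ) ≤ dist p q := by
    refine le_trans ?_ (dist_le_pi_dist p q μ)
    rw [Real.dist_eq, abs_sub_comm, abs_of_nonneg (by linarith)]
    linarith
  calc (1 : ℝ) ≤ lenIn (Metric.closedBall p 1) T :=
        le_lenIn_closedBall hT.connected.isPreconnected hpT hqT one_pos hdist
    _ ≤ len T := lenIn_le_len _ T

/-- Hence `d(X) ≥ 1` as soon as two cubes of `X` are two apart in some coordinate (and `X` has an admissible graph at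
all). [folklore] -/
theorem one_le_treeLen_of_far {X : Finset (Pt d)} (hne : ∃ T, Admissible X T) {x y : Pt d} (hx : x ∈ X)
    (hy : y ∈ X) {μ : Fin d} (hfar : x μ + 2 ≤ y μ) : 1 ≤ treeLen X :=
  le_treeLen hne fun _ hT => one_le_len_of_far hT hx hy hfar

/-- Either the cubes of `X` pairwise touch, or two of them are two apart in some coordinate (integers). [folklore] -/
theorem near_or_far (X : Finset (Pt d)) : Near X ∨ ∃ x ∈ X, ∃ y ∈ X, ∃ μ, x μ + 2 ≤ y μ := by
  by_cases h : Near X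
  · exact Or.inl h
  · right
    simp only [Near, not_forall, not_le] at h
    obtain ⟨x, hx, y, hy, μ, hμ⟩ := h
    exact ⟨x, hx, y, hy, μ, by omega⟩

/-- Junk value: an index set without admissible graphs (empty, or not connected through walls) has `treeLen X = 0`
(`sInf ∅ = 0`; convention (iii) of `…TreeLength`). [folklore] -/
theorem treeLen_eq_zero_of_no_admissible {X : Finset (Pt d)} (h : ¬ ∃ T, Admissible X T) : treeLen X = 0 := by
  have he : lengths X = ∅ := by
    ext ℓ
    simp only [lengths, Set.mem_setOf_eq, Set.mem_empty_iff_false, iff_false]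
    rintro ⟨T, hT, -⟩
    exact h ⟨T, hT⟩
  rw [treeLen, he, Real.sInf_empty]

/-- THE DICHOTOMY: for every finite `X ⊆ ℤᵈ`, `d(X) = 0` or `d(X) ≥ 1` — no linear size lies strictly between 0 and
1. [folklore] -/
theorem treeLen_dichotomy (X : Finset (Pt d)) : treeLen X = 0 ∨ 1 ≤ treeLen X := by
  by_cases hne : ∃ T, Admissible X T
  · rcases near_or_far X with h | ⟨x, hx, y, hy, μ, hμ⟩
    · obtain ⟨T, hT⟩ := hne
      exact Or.inl (treeLen_eq_zero_of_near hT.finset_nonempty h)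
    · exact Or.inr (one_le_treeLen_of_far hne hx hy hμ)
  · exact Or.inl (treeLen_eq_zero_of_no_admissible hne)

/-- `d(X) < 1 ↔ d(X) = 0`. [folklore] -/
theorem treeLen_lt_one_iff (X : Finset (Pt d)) : treeLen X < 1 ↔ treeLen X = 0 := by
  constructor
  · intro h
    rcases treeLen_dichotomy X with h0 | h1
    · exact h0
    · exact absurd h (not_lt.2 h1)
  · intro h
    rw [h]
    exact one_pos

/-- `d(X) > 0 ↔ d(X) ≥ 1`. [folklore] -/
theorem treeLen_pos_iff (X : Finset (Pt d)) : 0 < treeLen X ↔ 1 ≤ treeLen X := by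
  constructor
  · intro h
    rcases treeLen_dichotomy X with h0 | h1
    · rw [h0] at h
      exact absurd h (lt_irrefl 0)
    · exact h1
  · intro h
    linarith

/-- If `d(X) < 1` (and `X` has an admissible graph) the cubes of `X` pairwise touch. [folklore] -/
theorem near_of_treeLen_lt_one {X : Finset (Pt d)} (hne : ∃ T, Admissible X T) (h : treeLen X < 1) : Near X := by
  rcases near_or_far X with hn | ⟨x, hx, y, hy, μ, hμ⟩
  · exact hn
  · exact absurd h (not_lt.2 (one_le_treeLen_of_far hne hx hy hμ))

/-- Pairwise touching cubes lie in ONE BLOCK OF `2ᵈ` CUBES: coordinatewise the indices take only the values `m_μ`,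
`m_μ + 1` (`m_μ` the least one). [folklore] -/
theorem subset_piFinset_of_near {X : Finset (Pt d)} (hne : X.Nonempty) (h : Near X) :
    X ⊆ Fintype.piFinset fun μ => ({X.inf' hne fun x => x μ, (X.inf' hne fun x => x μ) + 1} : Finset ℤ) := by
  intro x hx
  rw [Fintype.mem_piFinset]
  intro μ
  obtain ⟨y, hy, hyeq⟩ := Finset.exists_mem_eq_inf' hne (fun x : Pt d => x μ)
  have h1 : X.inf' hne (fun x => x μ) ≤ x μ := Finset.inf'_le _ hx
  have h2 : x μ ≤ y μ + 1 := h y hy x hx μ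
  rw [hyeq] at h1 ⊢
  rw [Finset.mem_insert, Finset.mem_singleton]
  omega

/-- Hence pairwise touching cubes number at most `2ᵈ`. [folklore] -/
theorem card_le_two_pow_of_near {X : Finset (Pt d)} (hne : X.Nonempty) (h : Near X) : X.card ≤ 2 ^ d := by
  classical
  have hsub := subset_piFinset_of_near hne h
  have hbox : (Fintype.piFinset fun μ =>
      ({X.inf' hne fun x => x μ, (X.inf' hne fun x => x μ) + 1} : Finset ℤ)).card ≤ 2 ^ d := by
    rw [Fintype.card_piFinset]
    calc ∏ μ, ({X.inf' hne fun x => x μ, (X.inf' hne fun x => x μ) + 1} : Finset ℤ).card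
        ≤ ∏ _μ : Fin d, 2 := Finset.prod_le_prod' fun μ _ => Finset.card_le_two
      _ = 2 ^ d := by rw [Finset.prod_const, Finset.card_univ, Fintype.card_fin]
  exact (Finset.card_le_card hsub).trans hbox

/-- A LOCALIZATION DOMAIN OF LINEAR SIZE 0 HAS AT MOST `2ᵈ` CUBES: for face-connected `X` (the cell's reading of a domain,
`B13ScaleTransfer.FaceConnected`), `d(X) < 1` (equivalently `d(X) = 0`) forces `|X| ≤ 2ᵈ` — the exact small-set case of the
repaired volume bound `TreeLength.card_le_treeLen` (`|X| ≤ 2ᵈ(4d(X) + 1)`). [folklore] -/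
theorem card_le_two_pow_of_treeLen_lt_one {X : Finset (Pt d)} (hc : FaceConnected X) (h : treeLen X < 1) :
    X.card ≤ 2 ^ d := by
  rcases X.eq_empty_or_nonempty with rfl | hne
  · simp
  · obtain ⟨T, hT, -⟩ := exists_admissible hne hc
    exact card_le_two_pow_of_near hne (near_of_treeLen_lt_one ⟨T, hT⟩ h)

/-- For a non-empty face-connected `X`: `d(X) = 0` exactly when its cubes pairwise touch. [folklore] -/
theorem treeLen_eq_zero_iff_near {X : Finset (Pt d)} (hne : X.Nonempty) (hc : FaceConnected X) :
    treeLen X = 0 ↔ Near X := by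
  obtain ⟨T, hT, -⟩ := exists_admissible hne hc
  constructor
  · intro h
    exact near_of_treeLen_lt_one ⟨T, hT⟩ (by rw [h]; exact one_pos)
  · exact treeLen_eq_zero_of_near hne

/-! ## Part 2. The thresholds of [Balaban1989LargeFieldII] p. 384–385 in their printed form -/

/-- *"Let n₀ be the last index n such that d′_n(Z^{(n−j)}) > 0"* (p. 385) and the printed case split *"if the linear size
on the right-hand side is different from 0, or … if it is equal to 0"* (p. 384) — `B16SProfile.exists_threshold` with the
PRINTED thresholds `> 0` / `= 0` on the linear size of the cover `Z^{(i)}` in place of the typed `≥ 1` / `< 1` (equivalent by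
Part 1); the two-sided form «> 0 for 1 ≤ i ≤ i₀, = 0 for i₀ < i ≤ m» is the cell's READING of «last index» plus the
monotonicity `B16SProfile.treeLen_closureIdx_antitone`, not a quotation (v1.1, cell `GAPS.md` G-pv14-12).
[cite: Balaban1989LargeFieldII, p.385 (definition of n₀)] -/
theorem exists_threshold_printed {L : ℕ} (hL : 0 < L) (σ : ℕ → ℕ) (m : ℕ) {Z : Finset (Pt d)} (hZ : Z.Nonempty)
    (hZc : FaceConnected Z) :
    ∃ i₀, i₀ ≤ m ∧ (∀ i, 1 ≤ i → i ≤ i₀ → 0 < treeLen (closureIdx (Qprod (ratio L σ) i) Z)) ∧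
      (∀ i, i₀ < i → i ≤ m → treeLen (closureIdx (Qprod (ratio L σ) i) Z) = 0) := by
  obtain ⟨i₀, h0, hA, hB⟩ := exists_threshold hL σ m hZ hZc
  exact ⟨i₀, h0, fun i h1 h2 => (treeLen_pos_iff _).2 (hA i h1 h2),
    fun i h1 h2 => (treeLen_lt_one_iff _).1 (hB i h1 h2)⟩

/-- `B16SProfile.profile_h1` (binder `h1` of `Step.Budget.majorant_181`) under the PRINTED regime condition
`d′_{j+i}(Z^{(i)}) > 0`. [cite: Balaban1989LargeFieldII, (1.81) p.385] -/
theorem profile_h1_printed {L : ℕ} {σ : ℕ → ℕ} {m i : ℕ} (hL : 4 ≤ L) (h : DropCtl σ m)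
    {Z : Finset (Pt d)} (hZ : Z.Nonempty) (hZc : FaceConnected Z) (hi1 : 1 ≤ i) (hi : i ≤ m)
    (ht : 0 < treeLen (closureIdx (Qprod (ratio L σ) i) Z)) :
    treeLen (Siter (ratio L σ) i Z) ≤ 10 * 126 ^ d * (1 / 2 : ℝ) ^ i * treeLen Z :=
  profile_h1 hL h hZ hZc hi1 hi ((treeLen_pos_iff _).1 ht)

/-- `B16SProfile.profile_h2` (binder `h2` of `Step.Budget.majorant_181`) under the PRINTED regime condition
`d′_{j+i}(Z^{(i)}) = 0`. [cite: Balaban1989LargeFieldII, (1.81) p.385] -/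
theorem profile_h2_printed {L : ℕ} {σ : ℕ → ℕ} {m i : ℕ} (hL : 3 ≤ L) (h : DropCtl σ m)
    {Z : Finset (Pt d)} (hZ : Z.Nonempty) (hZc : FaceConnected Z) (hi : i ≤ m)
    (ht : treeLen (closureIdx (Qprod (ratio L σ) i) Z) = 0) :
    treeLen (Siter (ratio L σ) i Z) ≤ 5 * 126 ^ d :=
  profile_h2 hL h hZ hZc hi ((treeLen_lt_one_iff _).2 ht)

end

end Literature.MathematicalPhysics.QuantumFieldTheory.Balaban1983to89.TreeLengthDichotomy
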